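import Literature.AlgebraicGeometry.Motives.HypergeometricGroups
import HarnessLib

/-!
# Levelt's theorem (Beukers–Heckman 1989, Thm. 3.5): proof

Companion PROOFS file of `HypergeometricGroups.lean` (same topic directory): it discharges the
named fact `BeukersHeckman1989_levelt` vendored there —

> for `n ≥ 1` and non-zero parameters `a₁,…,aₙ, b₁,…,bₙ` with `a_j ≠ b_k`, a hypergeometric pair
> `(A, B)` (`det(X - A) = ∏ (X - a_j)`, `det(X - B) = ∏ (X - b_k)`, `rank(A - B) = 1`, `A, B`
> invertible) EXISTS, and any two such pairs are SIMULTANEOUSLY CONJUGATE in `GL(n, ℂ)`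

— by `theorem BeukersHeckman1989_levelt_holds : BeukersHeckman1989_levelt`, proved from Mathlib and
from the irreducibility criterion `BeukersHeckman1989_irreducible_holds` of the statement file, along
the lines of the printed proof (F. Beukers, G. Heckman, Invent. Math. 95 (1989), Thm. 3.5;
A. H. M. Levelt, thesis 1961), see the section docstring below. No new named fact; one new
definition, `compMatrix n f` (the companion-type matrix, Levelt's explicit generator).

## References

* [BeukersHeckman1989] F. Beukers, G. Heckman, *Monodromy for the hypergeometric function ₙF_{n-1}*,
  Invent. Math. 95 (1989), Thm. 3.5 and its proof.
-/

noncomputable section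

namespace Literature.AlgebraicGeometry.Motives

open Polynomial Matrix Module Module.End

/-! ### Discharge of Levelt's theorem (Thm. 3.5), proved from Mathlib

Proof as in Beukers–Heckman (and Levelt 1961): **uniqueness** — for a hypergeometric pair `(A, B)`
pick a Krylov vector `v ≠ 0` with `v, Av, …, Aⁿ⁻²v ∈ ker(A - B)` (`exists_krylov`, a dimension count);
then `Aⁱv = Bⁱv` for `i < n`, the span of `v, Av, …, Aⁿ⁻¹v` is stable under `A` (Cayley–Hamilton) and
`B`, hence is `ℂⁿ` by the irreducibility criterion `BeukersHeckman1989_irreducible_holds`, so these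
vectors form a basis in which `A` and `B` are the companion-type matrices `compMatrix n f`,
`compMatrix n g` (`exists_basis_toMatrix_eq_compMatrix`); two pairs are therefore simultaneously
conjugate (`conj_of_isHypergeometricPair`). **Existence** — the companion-type matrices themselves
form a hypergeometric pair (`isHypergeometricPair_compMatrix`: characteristic polynomials via
multiplication by `x̄` on `ℂ[X]/(f)`, invertibility from `f(0) ≠ 0`, and `rank (C_f - C_g) = 1`
because the two differ exactly in the last column). -/

section Levelt

variable {n : ℕ}

/-- `∏_{j : Fin n} (X - C a_j)` has degree `n`. [folklore] -/
theorem natDegree_prod_X_sub_C_fin (a : Fin n → ℂ) : (∏ j, (X - C (a j))).natDegree = n := by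
  rw [natDegree_prod_of_monic _ _ (fun j _ => monic_X_sub_C (a j))]
  simp

/-- `∏_{j : Fin n} (X - C a_j)` is monic. [folklore] -/
theorem monic_prod_X_sub_C_fin (a : Fin n → ℂ) : (∏ j, (X - C (a j))).Monic :=
  monic_prod_of_monic _ _ (fun j _ => monic_X_sub_C (a j))

/-- Cayley–Hamilton in power form for an endomorphism of `ℂⁿ` whose characteristic polynomial is a
monic polynomial `f` of degree `n`: `L ^ n = - ∑_{k < n} f.coeff k • L ^ k`. [folklore] -/
theorem pow_eq_neg_sum_of_charpoly (L : Module.End ℂ (Fin n → ℂ)) {f : ℂ[X]} (hf : L.charpoly = f)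
    (hmonic : f.Monic) (hdeg : f.natDegree = n) :
    L ^ n = - ∑ k : Fin n, f.coeff k • L ^ (k : ℕ) := by
  have h0 : aeval L f = 0 := hf ▸ LinearMap.aeval_self_charpoly L
  rw [aeval_eq_sum_range' (n := n + 1) (by omega), Finset.sum_range_succ, Finset.sum_range] at h0
  have hc : f.coeff n = 1 := by rw [← hdeg]; exact hmonic.coeff_natDegree
  rw [hc, one_smul] at h0
  exact eq_neg_of_add_eq_zero_right h0

/-- **A Krylov vector** (Beukers–Heckman's `v ∈ ⋂_{i ≤ n-2} A^{-i} ker(A - B)`): `v ≠ 0` with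
`(LA - LB) (LA^i v) = 0` for `i ≤ n - 2`, when `im(LA - LB)` is a line and `n ≥ 1` — by a dimension
count (`n - 1` linear conditions in an `n`-dimensional space). [cite: BeukersHeckman1989, proof of Thm. 3.5] -/
theorem exists_krylov (LA LB : Module.End ℂ (Fin n → ℂ)) (hn : 0 < n)
    (hD : Module.finrank ℂ (LinearMap.range (LA - LB)) = 1) :
    ∃ v : (Fin n → ℂ), v ≠ 0 ∧ ∀ i : ℕ, i + 1 < n → (LA - LB) ((LA ^ i) v) = 0 := by
  set D := LA - LB with hDdef
  let Φ : (Fin n → ℂ) →ₗ[ℂ] (Fin (n - 1) → LinearMap.range D) :=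
    LinearMap.pi fun i => D.rangeRestrict ∘ₗ (LA ^ (i : ℕ))
  have hlt : Module.finrank ℂ (Fin (n - 1) → LinearMap.range D) < Module.finrank ℂ (Fin n → ℂ) := by
    rw [Module.finrank_pi_fintype, Module.finrank_fin_fun]
    simp only [hD, Finset.sum_const, Finset.card_univ, Fintype.card_fin, smul_eq_mul, mul_one]
    omega
  obtain ⟨v, hv, hv0⟩ := Submodule.exists_mem_ne_zero_of_ne_bot (LinearMap.ker_ne_bot_of_finrank_lt hlt (f := Φ))
  refine ⟨v, hv0, fun i hi => ?_⟩
  have h1 : Φ v ⟨i, by omega⟩ = 0 := by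
    rw [LinearMap.mem_ker] at hv
    rw [hv]; rfl
  simpa [Φ] using congrArg Subtype.val h1

/-- Powers agree on a Krylov vector: `LA^i v = LB^i v` for `i < n`. [cite: BeukersHeckman1989, proof of Thm. 3.5] -/
theorem pow_apply_eq_of_krylov (LA LB : Module.End ℂ (Fin n → ℂ)) {v : (Fin n → ℂ)}
    (hv : ∀ i : ℕ, i + 1 < n → (LA - LB) ((LA ^ i) v) = 0) :
    ∀ i : ℕ, i < n → (LA ^ i) v = (LB ^ i) v := by
  intro i
  induction i with
  | zero => intro; simp
  | succ i ih =>
    intro hi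
    have h1 := hv i hi
    rw [LinearMap.sub_apply, sub_eq_zero] at h1
    rw [pow_succ', pow_succ', Module.End.mul_apply, Module.End.mul_apply, h1, ih (by omega)]


/-- The **companion-type matrix** attached to a polynomial `f` (of degree `n`): the columns are
`e₁, …, e_{n-1}` followed by `-(f₀, …, f_{n-1})ᵀ` — the matrix of multiplication by `x̄` on `ℂ[X]/(f)`
in the monomial basis; Levelt's explicit generators are `A = compMatrix n f`, `B = compMatrix n g`
(Beukers–Heckman 1989, Thm. 3.5). [cite: BeukersHeckman1989, Thm. 3.5] -/
def compMatrix (n : ℕ) (f : ℂ[X]) : Matrix (Fin n) (Fin n) ℂ :=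
  Matrix.of fun i j => if (j : ℕ) + 1 = n then -(f.coeff i) else if (i : ℕ) = j + 1 then 1 else 0

/-- **Levelt normal form**: every hypergeometric pair with pairwise distinct parameters is, in a
suitable basis (`v, Av, …, Aⁿ⁻¹v` for a Krylov vector `v`), the pair of companion-type matrices of
`f = ∏ (X - a_j)` and `g = ∏ (X - b_k)`. Proof: the span of the Krylov family is stable under `A`
(Cayley–Hamilton) and under `B` (powers agree), hence is everything by
`BeukersHeckman1989_irreducible_holds`; so the family is a basis, in which both matrices are read
off. [cite: BeukersHeckman1989, proof of Thm. 3.5] -/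
theorem exists_basis_toMatrix_eq_compMatrix (hn : 0 < n) {a b : Fin n → ℂ}
    {A B : Matrix (Fin n) (Fin n) ℂ} (h : IsHypergeometricPair a b A B) (hab : ∀ j k, a j ≠ b k) :
    ∃ β : Basis (Fin n) ℂ (Fin n → ℂ),
      LinearMap.toMatrix β β (Matrix.toLin' A) = compMatrix n (∏ j, (X - C (a j))) ∧
      LinearMap.toMatrix β β (Matrix.toLin' B) = compMatrix n (∏ k, (X - C (b k))) := by
  classical
  obtain ⟨hAu, hBu, hcA, hcB, hr⟩ := h
  set f : ℂ[X] := ∏ j, (X - C (a j)) with hfdef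
  set g : ℂ[X] := ∏ k, (X - C (b k)) with hgdef
  set LA : Module.End ℂ (Fin n → ℂ) := Matrix.toLin' A with hLA
  set LB : Module.End ℂ (Fin n → ℂ) := Matrix.toLin' B with hLB
  have hfin : Module.finrank ℂ (LinearMap.range (LA - LB)) = 1 := by
    have hsub : LA - LB = (A - B).mulVecLin := by
      rw [hLA, hLB, ← map_sub, Matrix.toLin'_apply']
    rw [hsub]
    exact hr
  obtain ⟨v, hv0, hv⟩ := exists_krylov LA LB hn hfin
  have hpow := pow_apply_eq_of_krylov LA LB hv
  have hchA : LA ^ n = -∑ k : Fin n, f.coeff k • LA ^ (k : ℕ) :=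
    pow_eq_neg_sum_of_charpoly LA (by rw [hLA, Matrix.charpoly_toLin', hcA])
      (monic_prod_X_sub_C_fin a) (natDegree_prod_X_sub_C_fin a)
  have hchB : LB ^ n = -∑ k : Fin n, g.coeff k • LB ^ (k : ℕ) :=
    pow_eq_neg_sum_of_charpoly LB (by rw [hLB, Matrix.charpoly_toLin', hcB])
      (monic_prod_X_sub_C_fin b) (natDegree_prod_X_sub_C_fin b)
  -- the Krylov family
  set w : Fin n → (Fin n → ℂ) := fun i => (LA ^ (i : ℕ)) v with hwdef
  have hwB : ∀ i : Fin n, w i = (LB ^ (i : ℕ)) v := fun i => hpow i i.2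
  have hAw : ∀ i : Fin n, LA (w i) =
      if h : (i : ℕ) + 1 < n then w ⟨i + 1, h⟩ else -∑ k : Fin n, f.coeff k • w k := by
    intro i
    have h1 : LA (w i) = (LA ^ ((i : ℕ) + 1)) v := by
      rw [hwdef, pow_succ', Module.End.mul_apply]
    rw [h1]
    split_ifs with h
    · rfl
    · have hi : (i : ℕ) + 1 = n := by omega
      rw [hi, hchA]
      simp [hwdef]
  have hBw : ∀ i : Fin n, LB (w i) =
      if h : (i : ℕ) + 1 < n then w ⟨i + 1, h⟩ else -∑ k : Fin n, g.coeff k • w k := by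
    intro i
    have h1 : LB (w i) = (LB ^ ((i : ℕ) + 1)) v := by
      rw [hwB i, pow_succ', Module.End.mul_apply]
    rw [h1]
    split_ifs with h
    · rw [← hpow _ h]
    · have hi : (i : ℕ) + 1 = n := by omega
      rw [hi, hchB]
      simp only [LinearMap.neg_apply, LinearMap.coe_sum, Finset.sum_apply, LinearMap.smul_apply, hwB]
  -- the span is invariant, hence everything
  set U : Submodule ℂ (Fin n → ℂ) := Submodule.span ℂ (Set.range w) with hU
  have hgenU : ∀ k : Fin n, w k ∈ U := fun k => Submodule.subset_span ⟨k, rfl⟩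
  have hUA : U.map LA ≤ U := by
    rw [Submodule.map_span_le]
    rintro _ ⟨i, rfl⟩
    rw [hAw i]
    split_ifs with h
    · exact hgenU _
    · exact U.neg_mem (U.sum_mem fun k _ => U.smul_mem _ (hgenU k))
  have hUB : U.map LB ≤ U := by
    rw [Submodule.map_span_le]
    rintro _ ⟨i, rfl⟩
    rw [hBw i]
    split_ifs with h
    · exact hgenU _
    · exact U.neg_mem (U.sum_mem fun k _ => U.smul_mem _ (hgenU k))
  have hUtop : U = ⊤ := by
    rcases BeukersHeckman1989_irreducible_holds a b A B ⟨hAu, hBu, hcA, hcB, hr⟩ hab U hUA hUB with h | h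
    · exfalso
      have hvU : v ∈ U := by
        have := hgenU ⟨0, hn⟩
        simpa [hwdef] using this
      rw [h, Submodule.mem_bot] at hvU
      exact hv0 hvU
    · exact h
  -- the Krylov basis
  have htop : ⊤ ≤ Submodule.span ℂ (Set.range w) := hUtop ▸ le_rfl
  have hcard : Fintype.card (Fin n) = Module.finrank ℂ (Fin n → ℂ) := by simp
  have hli : LinearIndependent ℂ w := linearIndependent_of_top_le_span_of_card_eq_finrank htop hcard
  let β : Basis (Fin n) ℂ (Fin n → ℂ) := Basis.mk hli htop
  have hβ : ∀ i, β i = w i := fun i => Basis.mk_apply hli htop i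
  -- matrix entries
  have key : ∀ (L : Module.End ℂ (Fin n → ℂ)) (p : ℂ[X]),
      (∀ i : Fin n, L (w i) = if h : (i : ℕ) + 1 < n then w ⟨i + 1, h⟩ else -∑ k : Fin n, p.coeff k • w k) →
      LinearMap.toMatrix β β L = compMatrix n p := by
    intro L p hL
    ext i j
    rw [LinearMap.toMatrix_apply, hβ j, hL j, compMatrix, Matrix.of_apply]
    by_cases hj : (j : ℕ) + 1 < n
    · rw [dif_pos hj, if_neg (by omega), ← hβ, β.repr_self, Finsupp.single_apply]
      by_cases hi : (i : ℕ) = j + 1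
      · rw [if_pos hi, if_pos (Fin.ext hi.symm)]
      · rw [if_neg hi, if_neg (fun h' => hi (by rw [← h']))]
    · rw [dif_neg hj, if_pos (by omega), map_neg]
      have hs : β.repr (∑ k : Fin n, p.coeff k • w k) = (fun k : Fin n => p.coeff k : Fin n → ℂ) := by
        have := β.repr_sum_self (fun k : Fin n => p.coeff k)
        simp only [hβ] at this
        exact this
      rw [Finsupp.neg_apply, hs]
  exact ⟨β, key LA f hAw, key LB g hBw⟩


/-- **The companion-type matrix of a monic `f` of degree `n ≥ 1` has characteristic polynomial
`f`**: it is the matrix of multiplication by `x̄` on `ℂ[X]/(f)` in the monomial basis (Mathlib's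
`Algebra.leftMulMatrix` for `AdjoinRoot.powerBasis`, `charpoly_leftMulMatrix`,
`AdjoinRoot.minpoly_powerBasis_gen_of_monic`). [folklore] -/
theorem charpoly_compMatrix {f : ℂ[X]} (hf : f.Monic) (hdeg : f.natDegree = n) :
    (compMatrix n f).charpoly = f := by
  classical
  have hf0 : f ≠ 0 := hf.ne_zero
  set pb := AdjoinRoot.powerBasis hf0 with hpb
  have hdim : pb.dim = n := by rw [hpb, AdjoinRoot.powerBasis_dim, hdeg]
  -- `gen ^ n = -∑ coeff k • gen ^ k`
  have hroot : aeval pb.gen f = 0 := by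
    rw [hpb, AdjoinRoot.powerBasis_gen, AdjoinRoot.aeval_eq, AdjoinRoot.mk_self]
  have hgen : pb.gen ^ n = -∑ k ∈ Finset.range n, f.coeff k • pb.gen ^ k := by
    rw [aeval_eq_sum_range' (n := n + 1) (by omega), Finset.sum_range_succ] at hroot
    have hc : f.coeff n = 1 := by rw [← hdeg]; exact hf.coeff_natDegree
    rw [hc, one_smul] at hroot
    exact eq_neg_of_add_eq_zero_right hroot
  have hgen' : pb.gen ^ n = ∑ k : Fin pb.dim, (-(f.coeff k)) • pb.basis k := by
    rw [hgen, PowerBasis.coe_basis]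
    simp only [neg_smul, Finset.sum_neg_distrib]
    rw [Fin.sum_univ_eq_sum_range (fun k => f.coeff k • pb.gen ^ k) pb.dim, hdim]
  have hM : Matrix.reindex (finCongr hdim) (finCongr hdim)
      (Algebra.leftMulMatrix pb.basis pb.gen) = compMatrix n f := by
    ext i j
    rw [Matrix.reindex_apply, Matrix.submatrix_apply, Algebra.leftMulMatrix_eq_repr_mul,
      compMatrix, Matrix.of_apply]
    simp only [finCongr_symm, finCongr_apply]
    have hbj : pb.basis (Fin.cast hdim.symm j) = pb.gen ^ (j : ℕ) := by
      simp [PowerBasis.coe_basis, Fin.val_cast]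
    rw [hbj, ← pow_succ']
    by_cases hj : (j : ℕ) + 1 < n
    · have hjd : (j : ℕ) + 1 < pb.dim := by omega
      have h1 : pb.gen ^ ((j : ℕ) + 1) = pb.basis ⟨(j : ℕ) + 1, hjd⟩ := by
        simp [PowerBasis.coe_basis]
      rw [h1, pb.basis.repr_self, Finsupp.single_apply,
        if_neg (show ¬ ((j : ℕ) + 1 = n) by omega)]
      have hiff : ((⟨(j : ℕ) + 1, hjd⟩ : Fin pb.dim) = Fin.cast hdim.symm i) ↔ ((i : ℕ) = j + 1) := by
        rw [Fin.ext_iff, Fin.val_cast]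
        exact ⟨fun h => h.symm, fun h => h.symm⟩
      by_cases hi : (i : ℕ) = j + 1
      · rw [if_pos hi, if_pos (hiff.2 hi)]
      · rw [if_neg hi, if_neg (mt hiff.1 hi)]
    · have hjn : (j : ℕ) + 1 = n := by omega
      rw [if_pos hjn, hjn, hgen', pb.basis.repr_sum_self]
      simp [Fin.val_cast]
  rw [← hM, Matrix.charpoly_reindex, charpoly_leftMulMatrix, hpb,
    AdjoinRoot.minpoly_powerBasis_gen_of_monic hf]

/-- The companion-type matrix of `∏ (X - a_j)` with all `a_j ≠ 0` is invertible
(`det = (-1)ⁿ f(0) = ∏ a_j`). [folklore] -/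
theorem isUnit_det_compMatrix {a : Fin n → ℂ} (ha : ∀ j, a j ≠ 0) :
    IsUnit (compMatrix n (∏ j, (X - C (a j)))).det := by
  rw [Matrix.det_eq_sign_charpoly_coeff,
    charpoly_compMatrix (monic_prod_X_sub_C_fin a) (natDegree_prod_X_sub_C_fin a),
    coeff_zero_eq_eval_zero, eval_prod]
  refine ((isUnit_one.neg).pow _).mul (isUnit_iff_ne_zero.2 ?_)
  rw [Finset.prod_ne_zero_iff]
  intro j _
  simpa using ha j

/-- Two distinct monic polynomials of degree `n` differ in some coefficient below `n`. [folklore] -/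
theorem exists_coeff_ne {f g : ℂ[X]} (hf : f.Monic) (hg : g.Monic) (hdf : f.natDegree = n)
    (hdg : g.natDegree = n) (hne : f ≠ g) : ∃ i : Fin n, f.coeff i ≠ g.coeff i := by
  by_contra h
  push Not at h
  apply hne
  ext i
  rcases lt_trichotomy i n with hi | rfl | hi
  · exact h ⟨i, hi⟩
  · rw [← hdf, hf.coeff_natDegree, hdf, ← hdg, hg.coeff_natDegree]
  · rw [coeff_eq_zero_of_natDegree_lt (by omega), coeff_eq_zero_of_natDegree_lt (by omega)]

/-- The companion-type matrices of two distinct monic polynomials of degree `n` differ by a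
matrix of rank one (they differ only in the last column). [folklore] -/
theorem rank_compMatrix_sub {f g : ℂ[X]} (hf : f.Monic) (hg : g.Monic) (hdf : f.natDegree = n)
    (hdg : g.natDegree = n) (hne : f ≠ g) (hn : 0 < n) :
    (compMatrix n f - compMatrix n g).rank = 1 := by
  classical
  set u : Fin n → ℂ := fun i => g.coeff i - f.coeff i with hu
  have hu0 : u ≠ 0 := by
    obtain ⟨i, hi⟩ := exists_coeff_ne hf hg hdf hdg hne
    intro h0
    have := congrFun h0 i
    simp only [hu, Pi.zero_apply, sub_eq_zero] at this
    exact hi this.symm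
  set last : Fin n := ⟨n - 1, by omega⟩ with hlast
  have hD : ∀ i j, (compMatrix n f - compMatrix n g) i j = if j = last then u i else 0 := by
    intro i j
    simp only [compMatrix, Matrix.sub_apply, Matrix.of_apply, hu]
    by_cases hjl : j = last
    · have hj : (j : ℕ) + 1 = n := by
        rw [hjl, hlast]
        simp only
        omega
      rw [if_pos hj, if_pos hj, if_pos hjl]
      ring
    · have hj : ¬ ((j : ℕ) + 1 = n) := fun h => hjl (Fin.ext (by rw [hlast]; simp only; omega))
      rw [if_neg hj, if_neg hj, if_neg hjl]
      split_ifs <;> ring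
  have hmul : ∀ x : Fin n → ℂ, (compMatrix n f - compMatrix n g) *ᵥ x = x last • u := by
    intro x
    ext i
    simp only [Matrix.mulVec, dotProduct, Pi.smul_apply, smul_eq_mul]
    rw [Finset.sum_eq_single last]
    · rw [hD, if_pos rfl, mul_comm]
    · intro j _ hj
      rw [hD, if_neg hj, zero_mul]
    · intro h
      exact absurd (Finset.mem_univ _) h
  have hrange : LinearMap.range (compMatrix n f - compMatrix n g).mulVecLin = ℂ ∙ u := by
    ext y
    simp only [LinearMap.mem_range, Matrix.mulVecLin_apply, hmul, Submodule.mem_span_singleton]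
    constructor
    · rintro ⟨x, rfl⟩
      exact ⟨x last, rfl⟩
    · rintro ⟨c, rfl⟩
      exact ⟨Pi.single last c, by simp⟩
  rw [Matrix.rank, hrange, finrank_span_singleton hu0]

/-- **Existence half of Levelt's theorem**: the companion-type matrices of `f = ∏ (X - a_j)` and
`g = ∏ (X - b_k)` form a hypergeometric pair, for non-zero pairwise distinct parameters.
[cite: BeukersHeckman1989, Thm. 3.5] -/
theorem isHypergeometricPair_compMatrix (hn : 0 < n) {a b : Fin n → ℂ} (ha : ∀ j, a j ≠ 0)
    (hb : ∀ k, b k ≠ 0) (hab : ∀ j k, a j ≠ b k) :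
    IsHypergeometricPair a b (compMatrix n (∏ j, (X - C (a j)))) (compMatrix n (∏ k, (X - C (b k)))) := by
  have hne : (∏ j, (X - C (a j))) ≠ ∏ k, (X - C (b k)) := by
    intro h
    have hr : (∏ k, (X - C (b k))).IsRoot (a ⟨0, hn⟩) := by
      rw [← h, Polynomial.isRoot_prod]
      exact ⟨⟨0, hn⟩, Finset.mem_univ _, by simp⟩
    rw [Polynomial.isRoot_prod] at hr
    obtain ⟨k, -, hk⟩ := hr
    rw [Polynomial.root_X_sub_C] at hk
    exact hab ⟨0, hn⟩ k hk.symm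
  exact ⟨isUnit_det_compMatrix ha, isUnit_det_compMatrix hb,
    charpoly_compMatrix (monic_prod_X_sub_C_fin a) (natDegree_prod_X_sub_C_fin a),
    charpoly_compMatrix (monic_prod_X_sub_C_fin b) (natDegree_prod_X_sub_C_fin b),
    rank_compMatrix_sub (monic_prod_X_sub_C_fin a) (monic_prod_X_sub_C_fin b)
      (natDegree_prod_X_sub_C_fin a) (natDegree_prod_X_sub_C_fin b) hne hn⟩


/-- **Uniqueness half of Levelt's theorem**: two hypergeometric pairs with the same pairwise
distinct parameters are simultaneously conjugate (both are conjugate to the companion pair, by the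
normal form). [cite: BeukersHeckman1989, Thm. 3.5] -/
theorem conj_of_isHypergeometricPair (hn : 0 < n) {a b : Fin n → ℂ} (hab : ∀ j k, a j ≠ b k)
    {A B A' B' : Matrix (Fin n) (Fin n) ℂ} (h : IsHypergeometricPair a b A B)
    (h' : IsHypergeometricPair a b A' B') :
    ∃ P : (Matrix (Fin n) (Fin n) ℂ)ˣ, A' = P.val * A * P.val⁻¹ ∧ B' = P.val * B * P.val⁻¹ := by
  classical
  obtain ⟨β, hA, hB⟩ := exists_basis_toMatrix_eq_compMatrix hn h hab
  obtain ⟨β', hA', hB'⟩ := exists_basis_toMatrix_eq_compMatrix hn h' hab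
  set e := Pi.basisFun ℂ (Fin n) with he
  have key : ∀ (M : Matrix (Fin n) (Fin n) ℂ) (γ : Basis (Fin n) ℂ (Fin n → ℂ)),
      M = e.toMatrix γ * LinearMap.toMatrix γ γ (Matrix.toLin' M) * γ.toMatrix e := by
    intro M γ
    rw [basis_toMatrix_mul_linearMap_toMatrix_mul_basis_toMatrix, he,
      LinearMap.toMatrix_eq_toMatrix', LinearMap.toMatrix'_toLin']
  have h1 : β.toMatrix e * e.toMatrix β = 1 := Basis.toMatrix_mul_toMatrix_flip _ _
  have h2 : e.toMatrix β' * β'.toMatrix e = 1 := Basis.toMatrix_mul_toMatrix_flip _ _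
  have h3 : β'.toMatrix e * e.toMatrix β' = 1 := Basis.toMatrix_mul_toMatrix_flip _ _
  have h4 : e.toMatrix β * β.toMatrix e = 1 := Basis.toMatrix_mul_toMatrix_flip _ _
  let P : (Matrix (Fin n) (Fin n) ℂ)ˣ :=
    ⟨e.toMatrix β' * β.toMatrix e, e.toMatrix β * β'.toMatrix e,
      by rw [Matrix.mul_assoc, ← Matrix.mul_assoc (β.toMatrix e), h1, Matrix.one_mul, h2],
      by rw [Matrix.mul_assoc, ← Matrix.mul_assoc (β'.toMatrix e), h3, Matrix.one_mul, h4]⟩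
  have hPinv : P.val⁻¹ = e.toMatrix β * β'.toMatrix e := by
    rw [← Matrix.coe_units_inv]
    rfl
  have conj : ∀ (M M' : Matrix (Fin n) (Fin n) ℂ) (Cm : Matrix (Fin n) (Fin n) ℂ),
      LinearMap.toMatrix β β (Matrix.toLin' M) = Cm →
      LinearMap.toMatrix β' β' (Matrix.toLin' M') = Cm → M' = P.val * M * P.val⁻¹ := by
    intro M M' Cm hM hM'
    rw [hPinv, key M' β', hM']
    conv_rhs => rw [key M β, hM]
    change e.toMatrix β' * Cm * β'.toMatrix e =
      e.toMatrix β' * β.toMatrix e * (e.toMatrix β * Cm * β.toMatrix e) * (e.toMatrix β * β'.toMatrix e)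
    simp only [Matrix.mul_assoc]
    rw [← Matrix.mul_assoc (β.toMatrix e) (e.toMatrix β), h1, Matrix.one_mul,
      ← Matrix.mul_assoc (β.toMatrix e) (e.toMatrix β), h1, Matrix.one_mul]
  exact ⟨P, conj A A' _ hA hA', conj B B' _ hB hB'⟩


/-- **Discharge of `BeukersHeckman1989_levelt`** (Beukers–Heckman 1989, Thm. 3.5 = Levelt 1961):
hypergeometric groups with given non-zero parameters `a_j ≠ b_k` exist (the companion pair) and are
unique up to conjugation — proved from Mathlib by the Krylov-basis argument of the section
docstring. [cite: BeukersHeckman1989, Thm. 3.5] -/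
theorem BeukersHeckman1989_levelt_holds : BeukersHeckman1989_levelt :=
  fun _ hn _ _ ha hb hab =>
    ⟨⟨_, _, isHypergeometricPair_compMatrix hn ha hb hab⟩,
      fun _ _ _ _ h h' => conj_of_isHypergeometricPair hn hab h h'⟩

end Levelt

end Literature.AlgebraicGeometry.Motives

end
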